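import Summits.Schanuel.Schanuel.Theorems.DiophantineDichotomyApproximationPropertyOrbitClusterBoundLemmas
import Summits.Schanuel.Schanuel.Theorems.DiophantineDichotomyApproximationPropertyOrbitClusterBoundArith

/-!
# Deficient lever lemmas I — non-singular embedding minors and their cluster bound

Line `orbit-interpolation-determinant` for the crux `ApproximationProperty` (stmt-Schanuel-6117, route
DiophantineDichotomy), registered sub-goal `orbitClusterBoundDeficient_of` (the DEFICIENT-RANK orbit
cluster bound, KERNEL-c8 §4 / KERNEL-c6 R1: the interpolation determinant on a maximal non-singular
MINOR, Galois-averaged), proved in `…OrbitClusterBoundDeficient.lean`, which imports this file.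
Everything here is PROVED; no definitions, no named facts. Registered sub-goals carried by this file:
`exists_embeddings_det_ne_zero`, `norm_det_minor_le`.

* `exists_injective_det_ne_zero`: an `F`-linearly independent finite family of vectors `E → F` has a
  non-singular square coordinate minor on DISTINCT coordinates (row rank = column rank).
* `linearIndependent_embeddings`, `exists_embeddings_det_ne_zero`: `ℚ`-linearly independent
  `y₁, …, y_r ∈ K` have `ℂ`-linearly independent embedding vectors `(σ(y_j))_σ` (extend to a
  `ℚ`-basis; the square embedding matrix of a basis has `det² = discr ≠ 0`), hence `r` distinct
  complex embeddings `S₀ a` with `det (S₀ a (y j))_{a,j} ≠ 0`.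
* `norm_det_minor_le`: the archimedean UPPER bound of the lever for an `r × r` minor whose rows are
  arbitrary complex embeddings `ρ a` applied to `y j = n^δ β^{α j}`: Taylor rows about the cluster
  centre `x` (`prod_pow_eq_sum_box`, `norm_det_le_of_cluster`, `quarter_rpow_sub_le_sum_tdeg`) give
  `‖det‖ ≤ ((δ+1)ᵗ)^k rad^⌈¼k^{1+1/t} − k⌉ r! ((2+‖x‖)^{2δ})^k (∏ₐ maxᵢ|ρ_a x̲ᵢ|)^δ`, `k` = number of
  rows with `ρ a (β)` within `rad` of `x`, `x̲ = (n, nβ)` — verbatim the landed `OrbitClusterBound`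
  bookkeeping with the index type `Fin r`.
-/

open Finset Matrix NumberField Module Height
open scoped nonZeroDivisors

-- `Summit.Schanuel.Schanuel.…` is the mandated summit/sub-problem namespace (single-conjunct summit):
set_option linter.dupNamespace false

namespace Summit.Schanuel.Schanuel.Cruxes.ApproximationProperty.OrbitInterpolationDeterminant

/-- From an `F`-linearly independent finite family of vectors `v j : E → F` (`E` finite):
distinct coordinates `f a ∈ E`, one per member, on which the square matrix `(v j (f a))_{a,j}`
is non-singular (row rank = column rank). -/
theorem exists_injective_det_ne_zero {F : Type*} [Field F] {ι E : Type*} [Fintype ι]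
    [DecidableEq ι] [Fintype E] (v : ι → E → F) (hv : LinearIndependent F v) :
    ∃ f : ι → E, Function.Injective f ∧ (Matrix.of fun a j => v j (f a)).det ≠ 0 := by
  classical
  let M : Matrix ι E F := Matrix.of v
  obtain ⟨κ, a, ha, hspan, hli⟩ := exists_linearIndependent' F M.col
  haveI : Fintype κ := Fintype.ofInjective a ha
  have hcard : Fintype.card κ = Fintype.card ι := by
    have h1 : finrank F (Submodule.span F (Set.range (M.col ∘ a))) = Fintype.card κ :=
      finrank_span_eq_card hli
    have h2 : M.rank = Fintype.card ι := LinearIndependent.rank_matrix (M := M) hv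
    rw [Matrix.rank_eq_finrank_span_cols] at h2
    rw [hspan] at h1
    exact h1.symm.trans h2
  let g : ι ≃ κ := (Fintype.equivOfCardEq hcard).symm
  refine ⟨a ∘ g, ha.comp g.injective, ?_⟩
  have hrows : LinearIndependent F (Matrix.of fun a' j => v j ((a ∘ g) a')).row := by
    have : (Matrix.of fun a' j => v j ((a ∘ g) a')).row = (M.col ∘ a) ∘ g := by
      funext a' j; rfl
    rw [this]
    exact hli.comp g g.injective
  have hU := Matrix.linearIndependent_rows_iff_isUnit.mp hrows
  exact ((Matrix.isUnit_iff_isUnit_det _).mp hU).ne_zero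

/-- `ℚ`-linearly independent elements `y j` of a number field `K` have `ℂ`-linearly independent
embedding vectors `(σ (y j))_{σ : K →ₐ[ℚ] ℂ}`: extend to a `ℚ`-basis, whose embedding matrix is
non-singular (its determinant squares to the discriminant). -/
theorem linearIndependent_embeddings {K : Type*} [Field K] [NumberField K] {r : ℕ}
    (y : Fin r → K) (hli : LinearIndependent ℚ y) :
    LinearIndependent ℂ (fun j : Fin r => fun σ : K →ₐ[ℚ] ℂ => σ (y j)) := by
  classical
  have hs : LinearIndepOn ℚ id (Set.range y) := hli.linearIndepOn_id
  let b := Module.Basis.extend hs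
  haveI : Fintype (hs.extend (Set.subset_univ (Set.range y))) :=
    FiniteDimensional.fintypeBasisIndex b
  have hcardT : Fintype.card (hs.extend (Set.subset_univ (Set.range y))) =
      Fintype.card (K →ₐ[ℚ] ℂ) := by
    rw [AlgHom.card, finrank_eq_card_basis b]
  let e : (hs.extend (Set.subset_univ (Set.range y))) ≃ (K →ₐ[ℚ] ℂ) :=
    Fintype.equivOfCardEq hcardT
  set N := Algebra.embeddingsMatrixReindex ℚ ℂ b e with hN
  have hdet : N.det ≠ 0 := by
    intro h0
    have h := Algebra.discr_eq_det_embeddingsMatrixReindex_pow_two ℚ ℂ b e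
    rw [← hN, h0, zero_pow two_ne_zero, map_eq_zero] at h
    exact Algebra.discr_not_zero_of_basis ℚ b h
  have hrows : LinearIndependent ℂ N.row :=
    Matrix.linearIndependent_rows_iff_isUnit.mpr
      ((Matrix.isUnit_iff_isUnit_det _).mpr (Ne.isUnit hdet))
  -- the members `y j` sit inside the extended basis
  let inc : Fin r → hs.extend (Set.subset_univ (Set.range y)) :=
    fun j => ⟨y j, Module.Basis.subset_extend hs (Set.mem_range_self j)⟩
  have hinc : Function.Injective inc := fun j j' h => hli.injective (by
    simpa [inc] using congrArg Subtype.val h)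
  have h1 : LinearIndependent ℂ (N.row ∘ inc) := hrows.comp inc hinc
  -- transport the coordinates along `e`
  have h2 : LinearIndependent ℂ (⇑(LinearEquiv.funCongrLeft ℂ ℂ e.symm) ∘ (N.row ∘ inc)) :=
    h1.map' (LinearEquiv.funCongrLeft ℂ ℂ e.symm).toLinearMap (LinearEquiv.ker _)
  have hfun : (fun j : Fin r => fun σ : K →ₐ[ℚ] ℂ => σ (y j)) =
      ⇑(LinearEquiv.funCongrLeft ℂ ℂ e.symm) ∘ (N.row ∘ inc) := by
    funext j σ
    simp only [Function.comp_apply, LinearEquiv.funCongrLeft_apply,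
      LinearMap.funLeft_apply, Matrix.row_apply, hN, Algebra.embeddingsMatrixReindex,
      Matrix.reindex_apply, Matrix.submatrix_apply, Equiv.refl_symm, Equiv.refl_apply,
      Equiv.symm_symm, Algebra.embeddingsMatrix_apply, Equiv.apply_symm_apply, inc]
    rw [Module.Basis.extend_apply_self]
  rw [hfun]
  exact h2

/-- Non-singular maximal minor of the embedding matrix of `ℚ`-linearly independent `y j ∈ K`:
`r` DISTINCT complex embeddings `S₀ a` with `det (S₀ a (y j))_{a,j} ≠ 0`. -/
theorem exists_embeddings_det_ne_zero : ∀ {K : Type} [Field K] [NumberField K] {r : ℕ} (y : Fin r → K), LinearIndependent ℚ y → ∃ S₀ : Fin r → (K →+* ℂ), Function.Injective S₀ ∧ (Matrix.of fun a j => S₀ a (y j)).det ≠ 0 := by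
  intro K _ _ r y hli
  classical
  obtain ⟨f, hf, hdet⟩ :=
    exists_injective_det_ne_zero (fun j (σ : K →ₐ[ℚ] ℂ) => σ (y j)) (linearIndependent_embeddings y hli)
  refine ⟨fun a => (f a).toRingHom, fun a a' h => hf (AlgHom.coe_ringHom_injective h), ?_⟩
  simpa using hdet

/-- **Cluster bound for an `r × r` embedding minor.** Rows `a` are complex embeddings `ρ a` of
`K` applied to the scaled monomials `y j = n^δ β^{α j}` (`|α j| ≤ δ`); if the rows `a ∈ S` put
`ρ a (β)` within `rad ≤ 1` of `x`, then (Taylor rows about `x`, `norm_det_le_of_cluster`,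
`quarter_rpow_sub_le_sum_tdeg`)
`‖det‖ ≤ ((δ+1)ᵗ)^{#S} · rad^⌈¼ #S^{1+1/t} − #S⌉ · r! · ((2+‖x‖)^{2δ})^{#S} · (∏ₐ maxᵢ ‖ρ a (x̲ᵢ)‖)^δ`
for the tuple `x̲ = (n, nβ₁, …, nβ_t)`. -/
theorem norm_det_minor_le : ∀ {K : Type} [Field K] [NumberField K] {t : ℕ}, 1 ≤ t → ∀ (β : Fin t → K) (δ : ℕ) {r : ℕ} (α : Fin r → Fin t → ℕ), (∀ j, ∑ l, α j l ≤ δ) → ∀ (n : ℕ), 0 < n → ∀ (y : Fin r → K), (∀ j, y j = (n : K) ^ δ * ∏ l, β l ^ α j l) → ∀ (xK : Fin (t + 1) → K), xK 0 = n → (∀ l : Fin t, xK l.succ = n * β l) → ∀ (ρ : Fin r → (K →+* ℂ)) (x : Fin t → ℂ) (rad : ℝ), 0 < rad → rad ≤ 1 → ∀ (S : Finset (Fin r)), (∀ a ∈ S, ‖(fun l => ρ a (β l)) - x‖ ≤ rad) → ‖(Matrix.of fun a j => ρ a (y j)).det‖ ≤ (((δ : ℝ) + 1) ^ t) ^ S.card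 * rad ^ ⌈(1 / 4 : ℝ) * (S.card : ℝ) ^ (1 + 1 / (t : ℝ)) - S.card⌉₊ * (r.factorial : ℝ) * (((2 + ‖x‖) ^ 2) ^ δ) ^ S.card * (∏ a, ⨆ i : Fin (t + 1), ‖ρ a (xK i)‖) ^ δ := by
  intro K _ _ t ht β δ r α hαdeg n hn0 y hy xK hxK0 hxKs ρ x rad hr0 hr1 S hS
  classical
  have hnR : (0 : ℝ) < n := by exact_mod_cast hn0
  set W : Matrix (Fin r) (Fin r) ℂ := Matrix.of fun a j => ρ a (y j) with hW
  let z : Fin r → Fin t → ℂ := fun a l => ρ a (β l)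
  have hzS : ∀ a ∈ S, ‖z a - x‖ ≤ rad := hS
  set Γ : Finset (Fin t → ℕ) := Fintype.piFinset fun _ : Fin t => Finset.range (δ + 1) with hΓdef
  have hΓne : Γ.Nonempty := ⟨fun _ => 0, by
    rw [hΓdef, Fintype.mem_piFinset]; intro; simp⟩
  have hΓcard : (Γ.card : ℝ) = ((δ : ℝ) + 1) ^ t := by
    rw [hΓdef, Fintype.card_piFinset, Finset.prod_const, Finset.card_range, Finset.card_univ,
      Fintype.card_fin]
    push_cast; ring
  let u : Fin r → (Fin t → ℕ) → ℂ := fun a γ => ∏ l, (z a l - x l) ^ γ l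
  let w : (Fin t → ℕ) → Fin r → ℂ := fun γ j =>
    (n : ℂ) ^ δ * ∏ l, ((Nat.choose (α j l) (γ l) : ℂ) * x l ^ (α j l - γ l))
  let deg : (Fin t → ℕ) → ℕ := fun γ => ∑ l, γ l
  set c2 : ℝ := ((2 + ‖x‖) ^ 2) ^ δ with hc2
  have hc2pos : 0 < c2 := by positivity
  set B : ℝ := (n : ℝ) ^ δ * c2 with hBdef
  have hB0 : 0 ≤ B := by positivity
  let Rv : Fin r → ℝ := fun a => ⨆ i : Fin (t + 1), ‖ρ a (xK i)‖
  have hRv_le : ∀ a i, ‖ρ a (xK i)‖ ≤ Rv a := fun a i =>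
    le_ciSup (Finite.bddAbove_range fun i : Fin (t + 1) => ‖ρ a (xK i)‖) i
  have hRv_n : ∀ a, (n : ℝ) ≤ Rv a := fun a => by
    have h := hRv_le a 0
    rwa [hxK0, map_natCast, Complex.norm_natCast] at h
  have hRv_pos : ∀ a, 0 < Rv a := fun a => hnR.trans_le (hRv_n a)
  have hRv_z : ∀ a l, (n : ℝ) * ‖z a l‖ ≤ Rv a := fun a l => by
    have h := hRv_le a l.succ
    rwa [hxKs, map_mul, map_natCast, norm_mul, Complex.norm_natCast] at h
  let R : Fin r → ℝ := fun a => Rv a ^ δ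
  have hR0 : ∀ a, 0 ≤ R a := fun a => pow_nonneg (hRv_pos a).le _
  set mreal : ℝ := 1 / 4 * (S.card : ℝ) ^ (1 + 1 / (t : ℝ)) - S.card with hmreal
  set m : ℕ := ⌈mreal⌉₊ with hmdef
  -- the rows of W are Taylor sums
  have hαl : ∀ j l, α j l ≤ δ := fun j l =>
    (Finset.single_le_sum (fun l _ => Nat.zero_le (α j l)) (Finset.mem_univ l)).trans (hαdeg j)
  have hWentry : ∀ a j, W a j = (n : ℂ) ^ δ * ∏ l, z a l ^ α j l := by
    intro a j
    simp only [hW, Matrix.of_apply, hy, map_mul, map_pow, map_natCast, map_prod, z]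
  have hrow : ∀ a ∈ S, W a = ∑ γ ∈ Γ, u a γ • w γ := by
    intro a _
    funext j
    rw [Finset.sum_apply, hWentry a j, prod_pow_eq_sum_box (z a) x (α j) (hαl j), Finset.mul_sum]
    refine Finset.sum_congr rfl fun γ _ => ?_
    simp only [Pi.smul_apply, smul_eq_mul, u, w]
    ring
  have hu : ∀ a ∈ S, ∀ γ ∈ Γ, ‖u a γ‖ ≤ rad ^ deg γ := fun a ha γ _ =>
    norm_prod_sub_pow_le (z a) x γ (hzS a ha)
  have hw : ∀ γ ∈ Γ, ∀ j, ‖w γ j‖ ≤ B := by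
    intro γ _ j
    simp only [w, norm_mul, norm_pow, Complex.norm_natCast, hBdef]
    exact mul_le_mul_of_nonneg_left (norm_prod_choose_mul_pow_le x (α j) γ (hαdeg j))
      (by positivity)
  have hWbd : ∀ a ∉ S, ∀ j, ‖W a j‖ ≤ R a := by
    intro a _ j
    rw [hWentry a j, norm_mul, norm_pow, Complex.norm_natCast, norm_prod]
    simp_rw [norm_pow]
    have hsplit : (n : ℝ) ^ δ * ∏ l, ‖z a l‖ ^ α j l =
        (n : ℝ) ^ (δ - ∑ l, α j l) * ∏ l, ((n : ℝ) * ‖z a l‖) ^ α j l := by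
      simp_rw [mul_pow, Finset.prod_mul_distrib, Finset.prod_pow_eq_pow_sum]
      rw [← mul_assoc, ← pow_add, Nat.sub_add_cancel (hαdeg j)]
    rw [hsplit]
    calc (n : ℝ) ^ (δ - ∑ l, α j l) * ∏ l, ((n : ℝ) * ‖z a l‖) ^ α j l
        ≤ Rv a ^ (δ - ∑ l, α j l) * ∏ l, Rv a ^ α j l := by
          refine mul_le_mul (pow_le_pow_left₀ hnR.le (hRv_n a) _)
            (Finset.prod_le_prod (fun l _ => pow_nonneg (mul_nonneg hnR.le (norm_nonneg _)) _)
              fun l _ => pow_le_pow_left₀ (mul_nonneg hnR.le (norm_nonneg _)) (hRv_z a l) _)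
            (Finset.prod_nonneg fun l _ => pow_nonneg (mul_nonneg hnR.le (norm_nonneg _)) _)
            (pow_nonneg (hRv_pos a).le _)
      _ = R a := by
          simp only [R]
          rw [Finset.prod_pow_eq_pow_sum, ← pow_add, Nat.sub_add_cancel (hαdeg j)]
  have hm : ∀ p : Fin r → (Fin t → ℕ), (∀ a ∈ S, p a ∈ Γ) → Set.InjOn p S →
      m ≤ ∑ a ∈ S, deg (p a) := by
    intro p _ hinj
    have hT := quarter_rpow_sub_le_sum_tdeg ht (S.image p)
    rw [Finset.card_image_of_injOn hinj, Finset.sum_image hinj] at hT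
    rw [hmdef]
    refine Nat.ceil_le.mpr ?_
    rw [hmreal]
    have e : ((∑ a ∈ S, deg (p a) : ℕ) : ℝ) = ∑ a ∈ S, ((∑ l, p a l : ℕ) : ℝ) := by
      simp [deg]
    rw [e]
    exact hT
  have hup := norm_det_le_of_cluster W S Γ hΓne u w deg rad B R m hr0.le hr1 hB0 hR0
    hrow hu hw hWbd hm
  rw [Fintype.card_fin] at hup
  -- § the archimedean product
  set A : ℝ := ∏ a, Rv a with hAdef
  have hBR : ∀ a, B ≤ R a * c2 := fun a => by
    rw [hBdef]
    exact mul_le_mul_of_nonneg_right (pow_le_pow_left₀ hnR.le (hRv_n a) _) hc2pos.le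
  have hprodR : ∏ a, R a = A ^ δ := by
    rw [hAdef, ← Finset.prod_pow]
  have htail : B ^ S.card * ∏ a ∈ univ.filter (· ∉ S), R a ≤ c2 ^ S.card * A ^ δ := by
    have h1 : B ^ S.card ≤ (∏ a ∈ S, R a) * c2 ^ S.card := by
      rw [← Finset.prod_const, ← Finset.prod_const, ← Finset.prod_mul_distrib]
      exact Finset.prod_le_prod (fun a _ => hB0) fun a _ => hBR a
    have h2 : (∏ a ∈ S, R a) * ∏ a ∈ univ.filter (· ∉ S), R a = ∏ a, R a := by
      rw [← Finset.prod_filter_mul_prod_filter_not univ (· ∈ S)]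
      congr 1
      exact Finset.prod_congr (by ext a; simp) fun _ _ => rfl
    have h3 : 0 ≤ ∏ a ∈ univ.filter (· ∉ S), R a := Finset.prod_nonneg fun a _ => hR0 a
    calc B ^ S.card * ∏ a ∈ univ.filter (· ∉ S), R a
        ≤ ((∏ a ∈ S, R a) * c2 ^ S.card) * ∏ a ∈ univ.filter (· ∉ S), R a :=
          mul_le_mul_of_nonneg_right h1 h3
      _ = c2 ^ S.card * ((∏ a ∈ S, R a) * ∏ a ∈ univ.filter (· ∉ S), R a) := by ring
      _ = c2 ^ S.card * A ^ δ := by rw [h2, hprodR]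
  have h0 : 0 ≤ (Γ.card : ℝ) ^ S.card * rad ^ m * (r.factorial : ℝ) := by positivity
  calc ‖W.det‖ ≤ (Γ.card : ℝ) ^ S.card * rad ^ m * (r.factorial : ℝ) * B ^ S.card *
        ∏ a ∈ univ.filter (· ∉ S), R a := hup
    _ = ((Γ.card : ℝ) ^ S.card * rad ^ m * (r.factorial : ℝ)) *
        (B ^ S.card * ∏ a ∈ univ.filter (· ∉ S), R a) := by ring
    _ ≤ ((Γ.card : ℝ) ^ S.card * rad ^ m * (r.factorial : ℝ)) * (c2 ^ S.card * A ^ δ) :=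
        mul_le_mul_of_nonneg_left htail h0
    _ = _ := by rw [hΓcard, hAdef, hc2]; ring

end Summit.Schanuel.Schanuel.Cruxes.ApproximationProperty.OrbitInterpolationDeterminant
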